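import Summits.ResolutionOfSingularities.ResolutionOfSingularities.Theorems.SyzygyFlatteningGlobalisationCentreChart
import Summits.ResolutionOfSingularities.ResolutionOfSingularities.Theorems.SyzygyFlatteningHigherRankTerminationNrmLocAt
import Summits.ResolutionOfSingularities.ResolutionOfSingularities.Theorems.SyzygyFlatteningHigherRankTerminationEssFiniteType
import Literature.AlgebraicGeometry.Resolution.ProperModelsModification
import Literature.AlgebraicGeometry.Resolution.ProperModelsFunctionField
import Literature.AlgebraicGeometry.Resolution.ResolutionOfCurves
import HarnessLib

/-!
# The normalisation of a proper model and its local rings at centres — `stub_normalizationStage`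

Crux `SyzygyFlattening.Globalisation` (stmt-ResolutionOfSingularities-17061), line `birth`,
registered stub `stub_normalizationStage`: the NORMALISATION half of the one-step operator
`B ↦ locAt 𝒪_v (nrm (chart 𝒪_v B))` realised globally. For a proper model `M` of `K/k`
(`ProperModel k K`, `Literature/…/ProperModels.lean`) the normalisation
`ν : M^ν = normalization M.X → M.X` (`Literature/…/NormalizationOfVarieties.lean`, Mathlib's
relative normalisation of `M.X` in `Spec K(M)`) is finite (E. Noether, Liu 2002, Prop. 4.1.27,
`isFinite_normalizationι … NoetherFiniteIntegralClosure_holds`), hence proper, with integral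
source, and an isomorphism over a non-empty normal affine open
(`exists_isAffineOpen_isIntegrallyClosed`, `isIso_normalizationι_morphismRestrict`,
`ResolutionOfCurves.lean`); so `M^ν` is a proper model `M'` of `K/k` dominating `M`
(`ProperModel.ofModification`, `ProperModelsModification.lean`) —
`normalizationStage_exists_model`, `normalizationStage_exists_normalModel` (existence form: no
new definitions are introduced).

The stalk identity. Write (in this docstring only) `sec_U^P : Γ(P, U) → K(P) ≅ K` and
`toK_x^P : 𝒪_{P,x} → K(P) ≅ K` for a proper model `P`. For `v ∈ Zar(K/k)` with centre `x` on
`M` and `x'` on `M'` (`ν x' = x`), an affine open `U ∋ x` with chart `A = im sec_U^M ⊆ K` and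
`V = ν⁻¹U ∋ x'` (affine) with chart `A' = im sec_V^{M'}`:

* `normalizationStage_secToK_app` — `sec_{φ⁻¹U}^N ∘ φ^* = sec_U^M` for any morphism of proper
  models `φ : N → M` (the function fields are identified with `K` compatibly,
  `ProperModel.funFieldIso_hom_functionFieldMap`);
* `normalizationStage_isIntegrallyClosed_sections` — `Γ(M^ν, ν⁻¹U) ≅` the integral closure of
  `Γ(M, U)` in `K(M)` (`Scheme.Hom.normalizationObjIso`) is integrally closed;
* `normalizationStage_chart_eq_nrm` — hence `A' = nrm A` (the `k`-subalgebra of elements of `K`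
  integral over `A`): `⊆` since `ν^*` is integral (`IsIntegralHom`), `⊇` since `A ⊆ A'`,
  `A' ≅ Γ(M^ν, ν⁻¹U)` is integrally closed and `Frac A' = K`;
* `stub_normalizationStage` — with the chart dictionary (`stub_centreChart`, the hypothesis):
  `im toK_x^M = locAt 𝒪_v A`, `im toK_{x'}^{M'} = locAt 𝒪_v A' = locAt 𝒪_v (nrm A)
  = locAt 𝒪_v (nrm (locAt 𝒪_v A))` (`stub_nrm_locAt`: normalisation commutes with localisation).

Sources: Liu 2002, Def. 4.1.24, Prop. 4.1.27, Cor. 4.1.30 (normalisation of a variety);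
Zariski–Samuel II, Ch. VI §17 (models, centres, the normalisation of a complete model).
-/

noncomputable section

-- single-problem summit: the doubled namespace component `ResolutionOfSingularities` is forced
set_option linter.dupNamespace false

namespace Summit.ResolutionOfSingularities.ResolutionOfSingularities.Theorems.SyzygyFlattening

open CategoryTheory AlgebraicGeometry TopologicalSpace IsLocalRing
open Literature.AlgebraicGeometry.Resolution Literature.AlgebraicGeometry.Motives

universe u

/-! ## Sections in `K` along a morphism of proper models -/

section Model

variable {k K : Type u} [Field k] [Field K] [Algebra k K]

/-- **`sec_{φ⁻¹U}^N ∘ φ^* = sec_U^M`**: for a morphism of proper models `φ : N → M`, an open `U`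
of `M` and `f ∈ Γ(M, U)`, the image in `K` of `φ^* f ∈ Γ(N, φ⁻¹U)` (germ at the generic point of
`N`, then `K(N) ≅ K`) is the image in `K` of `f` — the field map `φ^♯ : K(M) → K(N)` is the
identity of `K` under the identifications (`ProperModel.funFieldIso_hom_functionFieldMap`) and
is compatible with germs (`Scheme.Hom.germ_stalkMap`). [cite: ZariskiSamuel1960, Ch. VI §17] -/
theorem normalizationStage_secToK_app {N M : ProperModel k K} (φ : N.Hom M) {U : M.X.Opens}
    (hU' : genericPoint M.X ∈ U) (hV' : genericPoint N.X ∈ φ.f ⁻¹ᵁ U) (f : Γ(M.X, U)) :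
    (N.X.presheaf.germ (φ.f ⁻¹ᵁ U) (genericPoint N.X) hV' ≫ N.funFieldIso.hom).hom
        ((φ.f.app U).hom f) =
      (M.X.presheaf.germ U (genericPoint M.X) hU' ≫ M.funFieldIso.hom).hom f := by
  have h1 : RatFn.functionFieldMap φ.f ((M.X.presheaf.germ U (genericPoint M.X) hU').hom f) =
      (N.X.presheaf.germ (φ.f ⁻¹ᵁ U) (genericPoint N.X) hV').hom ((φ.f.app U).hom f) := by
    simp only [RatFn.functionFieldMap, CommRingCat.hom_comp, RingHom.coe_comp,
      Function.comp_apply]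
    rw [← CommRingCat.comp_apply (M.X.presheaf.germ U _ hU') (M.X.presheaf.stalkSpecializes _),
      TopCat.Presheaf.germ_stalkSpecializes, Scheme.Hom.germ_stalkMap_apply]
  calc (N.X.presheaf.germ (φ.f ⁻¹ᵁ U) (genericPoint N.X) hV' ≫ N.funFieldIso.hom).hom
        ((φ.f.app U).hom f)
      = N.funFieldIso.hom.hom (RatFn.functionFieldMap φ.f
          ((M.X.presheaf.germ U (genericPoint M.X) hU').hom f)) := by rw [h1]; rfl
    _ = (M.X.presheaf.germ U (genericPoint M.X) hU' ≫ M.funFieldIso.hom).hom f := by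
        rw [ProperModel.funFieldIso_hom_functionFieldMap]; rfl

/-- `Γ(P, U) → K` (germ at the generic point, then `K(P) ≅ K`) is injective for a proper model
`P` (germs of the integral scheme `P` are injective). [folklore] -/
theorem normalizationStage_secToK_injective (P : ProperModel k K) {U : P.X.Opens}
    (hU' : genericPoint P.X ∈ U) :
    Function.Injective (P.X.presheaf.germ U (genericPoint P.X) hU' ≫ P.funFieldIso.hom).hom :=
  P.funFieldIso.commRingCatIsoToRingEquiv.injective.comp
    (germ_injective_of_isIntegral P.X (genericPoint P.X) hU')

/-- The carrier form of the chart (as produced by `stub_centreChart`: image of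
`Γ(P, U) → 𝒪_{P,x} → K`) gives the subring form (image of `Γ(P, U) → K(P) ≅ K`), by
`TopCat.Presheaf.germ_stalkSpecializes`. [folklore] -/
theorem normalizationStage_toSubring_eq_secRange (P : ProperModel k K) {U : P.X.Opens} {x : P.X}
    (hx : x ∈ U) (A : Subalgebra k K)
    (hAc : (A : Set K) = Set.range
      (((P.X.presheaf.stalkSpecializes (genericPoint_specializes x) ≫ P.funFieldIso.hom).hom).comp
        (P.X.presheaf.germ U x hx).hom)) :
    A.toSubring = (P.X.presheaf.germ U (genericPoint P.X) (centreChart_genericPoint_mem hx) ≫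
      P.funFieldIso.hom).hom.range := by
  -- adapted from `isOpen_setOf_regCentre_of_chart` (…GlobalisationRegCentreOpen.lean)
  refine SetLike.ext' ?_
  rw [Subalgebra.coe_toSubring, hAc, RingHom.coe_range]
  ext z
  constructor
  · rintro ⟨f, rfl⟩
    exact ⟨f, (centreChart_stalkToK_germ P hx f).symm⟩
  · rintro ⟨f, rfl⟩
    exact ⟨f, centreChart_stalkToK_germ P hx f⟩

end Model

/-! ## The sections of the normalisation over an affine open are integrally closed -/

/-- **`Γ(X^ν, ν⁻¹U)` is an integrally closed domain** for an affine open `U ≠ ∅` of the integral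
scheme `X`: it is `≅` the integral closure of `Γ(X, U)` in `Γ(Spec K(X), ξ⁻¹U) ≅ K(X)`
(`Scheme.Hom.normalizationObjIso`, `functionFieldAlgEquivSections`), i.e. in the fraction field
of `Γ(X, U)`, which is integrally closed (Liu 2002, Def. 4.1.24 with Prop. 4.1.22).
[cite: Liu2002, Def. 4.1.24, p. 121] -/
theorem normalizationStage_isIntegrallyClosed_sections (X : Scheme.{u}) [IsIntegral X]
    {U : X.Opens} (hU : IsAffineOpen U) [Nonempty U] :
    IsIntegrallyClosed Γ(normalization X, normalizationι X ⁻¹ᵁ U) := by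
  -- adapted from `isIntegrallyClosed_stalk_normalization` (AlterationsNormalizationReduction.lean)
  letI := ((fromSpecFunctionField X).app U).hom.toAlgebra
  let A := Γ(X, U)
  haveI : IsFractionRing A X.functionField := functionField_isFractionRing_of_isAffineOpen X U hU
  haveI : IsIntegrallyClosed (integralClosure A X.functionField) :=
    integralClosure.isIntegrallyClosedOfFiniteExtension (K := X.functionField)
      (L := X.functionField)
  let e := functionFieldAlgEquivSections (X := X) U
  let e₁ : integralClosure A X.functionField ≃+*
      integralClosure A Γ(Spec X.functionField, fromSpecFunctionField X ⁻¹ᵁ U) :=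
    (((integralClosure A X.functionField).equivMapOfInjective e.toAlgHom
      e.injective).trans (Subalgebra.equivOfEq _ _ (integralClosure_map_algEquiv e))).toRingEquiv
  let e₂ := ((fromSpecFunctionField X).normalizationObjIso hU).commRingCatIsoToRingEquiv
  exact IsIntegrallyClosed.of_equiv (e₁.trans e₂.symm)

/-! ## The chart of the normalisation is the normalisation of the chart -/

section Chart

variable {k K : Type} [Field k] [Field K] [Algebra k K]

/-- **The chart of `N` over `φ⁻¹U` is `nrm` of the chart of `M` over `U`** for a morphism of
proper models `φ : N → M` which is integral on `U` with `Γ(N, φ⁻¹U)` integrally closed and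
`Frac A' = K`: if `A ⊆ K` is the image of `Γ(M, U) → K` and `A'` that of `Γ(N, φ⁻¹U) → K`, then
`A' = nrm A = k[{y | y integral over A}]`. `⊆`: a section of `N` over `φ⁻¹U` satisfies a monic
equation over `Γ(M, U)`, read in `K` over `A` (`normalizationStage_secToK_app`); `⊇`: `A ⊆ A'`
and `A' ≅ Γ(N, φ⁻¹U)` is integrally closed in `K = Frac A'`. (Liu 2002, Prop. 4.1.27 / Def.
4.1.24: the normalisation over an affine `Spec A` is `Spec` of the integral closure of `A`.)
[cite: Liu2002, Def. 4.1.24, p. 121] -/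
theorem normalizationStage_chart_eq_nrm {N M : ProperModel k K} (φ : N.Hom M) {U : M.X.Opens}
    (hU' : genericPoint M.X ∈ U) (hV' : genericPoint N.X ∈ φ.f ⁻¹ᵁ U)
    (hint : (φ.f.app U).hom.IsIntegral) (hic : IsIntegrallyClosed Γ(N.X, φ.f ⁻¹ᵁ U))
    (A A' : Subalgebra k K)
    (hA : A.toSubring =
      (M.X.presheaf.germ U (genericPoint M.X) hU' ≫ M.funFieldIso.hom).hom.range)
    (hA' : A'.toSubring =
      (N.X.presheaf.germ (φ.f ⁻¹ᵁ U) (genericPoint N.X) hV' ≫ N.funFieldIso.hom).hom.range)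
    [IsFractionRing ↥A' K] : A' = nrm A := by
  set secM := (M.X.presheaf.germ U (genericPoint M.X) hU' ≫ M.funFieldIso.hom).hom with hsecM
  set secN := (N.X.presheaf.germ (φ.f ⁻¹ᵁ U) (genericPoint N.X) hV' ≫ N.funFieldIso.hom).hom
    with hsecN
  have hmemA : ∀ y, y ∈ A ↔ ∃ f, secM f = y := fun y => by
    rw [← Subalgebra.mem_toSubring, hA]; exact RingHom.mem_range
  have hmemA' : ∀ y, y ∈ A' ↔ ∃ s, secN s = y := fun y => by
    rw [← Subalgebra.mem_toSubring, hA']; exact RingHom.mem_range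
  have hcomp : secN.comp (φ.f.app U).hom = secM :=
    RingHom.ext fun f => normalizationStage_secToK_app φ hU' hV' f
  -- `A ≤ A'` along `φ^*`
  have hle : A ≤ A' := fun y hy => by
    obtain ⟨f, rfl⟩ := (hmemA y).mp hy
    exact (hmemA' _).mpr ⟨(φ.f.app U).hom f, normalizationStage_secToK_app φ hU' hV' f⟩
  apply le_antisymm
  · -- `A' ≤ nrm A`: sections of `N` over `φ⁻¹U` are integral over `Γ(M, U)`
    intro z hz
    obtain ⟨s, rfl⟩ := (hmemA' z).mp hz
    obtain ⟨p, hp, hps⟩ := hint s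
    rw [mem_nrm_iff]
    -- `Γ(M, U) → A`, the corestriction of `secM`
    let g : Γ(M.X, U) →+* ↥A := secM.codRestrict A fun f => (hmemA _).mpr ⟨f, rfl⟩
    have hg : (algebraMap ↥A K).comp g = secM := RingHom.ext fun _ => rfl
    refine ⟨p.map g, hp.map g, ?_⟩
    rw [Polynomial.eval₂_map, hg, ← hcomp, ← Polynomial.hom_eval₂, hps, map_zero]
  · -- `nrm A ≤ A'`: `A'` is integrally closed in `K = Frac A'` and contains `A`
    intro y hy
    rw [mem_nrm_iff] at hy
    have hy' : IsIntegral ↥A' y := isIntegral_of_le hle hy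
    have hinj : Function.Injective secN := normalizationStage_secToK_injective N hV'
    let e : Γ(N.X, φ.f ⁻¹ᵁ U) ≃+* ↥A'.toSubring :=
      (RingEquiv.ofBijective secN.rangeRestrict
        ⟨fun a b h => hinj (congrArg Subtype.val h), RingHom.rangeRestrict_surjective secN⟩).trans
        (RingEquiv.subringCongr hA'.symm)
    haveI : IsIntegrallyClosed ↥A' := @IsIntegrallyClosed.of_equiv _ _ _ _ e hic
    obtain ⟨a, ha⟩ := IsIntegrallyClosed.algebraMap_eq_of_integral hy'
    rw [← ha]
    exact a.2

end Chart

/-! ## The normalisation of a proper model as a proper model -/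

section NormalizationModel

variable {k K : Type u} [Field k] [Field K] [Algebra k K]

/-- **The normalisation `M^ν → M` of a proper model `M` of `K/k` is a proper model of `K/k`
dominating `M`** (Zariski–Samuel II, Ch. VI §17: the derived normal model): `ν` is finite
(E. Noether; Liu 2002, Cor. 4.1.30, `isFinite_normalizationι … NoetherFiniteIntegralClosure_holds`)
hence proper, `M^ν` is integral, and `ν` is an isomorphism over a non-empty normal affine open
(`exists_isAffineOpen_isIntegrallyClosed`, `isIso_normalizationι_morphismRestrict`), so
`ProperModel.ofModification` applies. Stated as: some proper model `M'` with a morphism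
`φ : M' → M` has underlying scheme `normalization M.X` and underlying morphism `normalizationι M.X`.
[cite: ZariskiSamuel1960, Ch. VI §17] -/
theorem normalizationStage_exists_model (M : ProperModel k K) :
    ∃ (M' : ProperModel k K) (φ : M'.Hom M) (e : M'.X = normalization M.X),
      φ.f = eqToHom e ≫ normalizationι M.X := by
  obtain ⟨W, hW, hWne, hic⟩ :=
    exists_isAffineOpen_isIntegrallyClosed M.X NoetherFiniteIntegralClosure_holds M.π
  haveI := isIso_normalizationι_morphismRestrict M.X hW hWne hic
  haveI : IsFinite (normalizationι M.X) :=
    isFinite_normalizationι M.X NoetherFiniteIntegralClosure_holds M.π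
  exact ⟨ProperModel.ofModification M (normalizationι M.X) W hWne,
    ProperModel.ofModificationHom M (normalizationι M.X) W hWne, rfl, by simp⟩

/-- **The normalisation model, property form**: every proper model `M` of `K/k` is dominated by a
proper model `φ : M' → M` with `φ` an integral morphism and `Γ(M', φ⁻¹U)` an integrally closed
domain for every non-empty affine open `U` of `M` — namely `M' = M^ν`, `φ = ν`
(`normalizationStage_exists_model`, `normalizationStage_isIntegrallyClosed_sections`).
[cite: ZariskiSamuel1960, Ch. VI §17] -/
theorem normalizationStage_exists_normalModel (M : ProperModel k K) :
    ∃ (M' : ProperModel k K) (φ : M'.Hom M), IsIntegralHom φ.f ∧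
      ∀ (U : M.X.Opens), IsAffineOpen U → Nonempty U →
        IsIntegrallyClosed Γ(M'.X, φ.f ⁻¹ᵁ U) := by
  obtain ⟨W, hW, hWne, hic⟩ :=
    exists_isAffineOpen_isIntegrallyClosed M.X NoetherFiniteIntegralClosure_holds M.π
  haveI := isIso_normalizationι_morphismRestrict M.X hW hWne hic
  haveI : IsFinite (normalizationι M.X) :=
    isFinite_normalizationι M.X NoetherFiniteIntegralClosure_holds M.π
  refine ⟨ProperModel.ofModification M (normalizationι M.X) W hWne,
    ProperModel.ofModificationHom M (normalizationι M.X) W hWne,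
    inferInstanceAs (IsIntegralHom (normalizationι M.X)), fun U hU _ => ?_⟩
  exact normalizationStage_isIntegrallyClosed_sections M.X hU

end NormalizationModel

/-! ## The registered stub -/

/-- **STUB `stub_normalizationStage`.** Given the chart dictionary at centres
(`stub_centreChart`), every proper model `M` of `K/k` is dominated by its normalisation
`M' = M^ν` (a proper model: `ν` is finite by E. Noether, and an isomorphism over a normal dense
open), and for every `v ∈ Zar(K/k)`, if `C ⊆ K` is the local ring of `M` at the centre of `v`
then the local ring of `M'` at the centre of `v` is `locAt 𝒪_v (nrm C)`: with an affine chart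
`U = Spec A ∋ centre`, `C = A_{𝔪_v ∩ A}`, `ν⁻¹U = Spec A'` with `A' =` the integral closure
`nrm A` of `A` in `K`, the local ring upstairs is `(nrm A)_{𝔪_v ∩ nrm A} = locAt 𝒪_v (nrm A)
= locAt 𝒪_v (nrm (locAt 𝒪_v A))` (normalisation commutes with localisation, `stub_nrm_locAt`).
[cite: ZariskiSamuel1960, Ch. VI §17] -/
theorem stub_normalizationStage :
    (∀ (k K : Type) [Field k] [Field K] [Algebra k K]
      (M : ProperModel k K) (v : ZariskiRiemannSpace k K) (U : M.X.Opens) (_hU : IsAffineOpen U)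
      (hx : M.centre v ∈ U),
      Function.Injective
          ((M.X.presheaf.stalkSpecializes (genericPoint_specializes (M.centre v)) ≫
            M.funFieldIso.hom).hom) ∧
        ∃ A : Subalgebra k K,
          (A : Set K) = Set.range
            (((M.X.presheaf.stalkSpecializes (genericPoint_specializes (M.centre v)) ≫
                M.funFieldIso.hom).hom).comp (M.X.presheaf.germ U (M.centre v) hx).hom) ∧
          A.FG ∧ IsFractionRing ↥A K ∧ A.toSubring ≤ v.asValuationSubring.toSubring ∧
          (locAt v.asValuationSubring A).toSubring =
            ((M.X.presheaf.stalkSpecializes (genericPoint_specializes (M.centre v)) ≫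
              M.funFieldIso.hom).hom).range) →
    ∀ (k K : Type) [Field k] [Field K] [Algebra k K]
    (M : ProperModel k K), ∃ (M' : ProperModel k K) (_ : M'.Hom M),
      ∀ (v : ZariskiRiemannSpace k K) (C : Subalgebra k K),
        C.toSubring = ((M.X.presheaf.stalkSpecializes (genericPoint_specializes (M.centre v)) ≫
            M.funFieldIso.hom).hom).range →
        (locAt v.asValuationSubring (nrm C)).toSubring =
          ((M'.X.presheaf.stalkSpecializes (genericPoint_specializes (M'.centre v)) ≫
            M'.funFieldIso.hom).hom).range := by
  intro hchart k K _ _ _ M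
  obtain ⟨M', φ, hφ, hnorm⟩ := normalizationStage_exists_normalModel M
  haveI := hφ
  refine ⟨M', φ, fun v C hC => ?_⟩
  -- an affine chart `U ∋ x = centre_M v` and its preimage `V = φ⁻¹U ∋ x' = centre_{M'} v`
  obtain ⟨U, hU, hxU, -⟩ := exists_isAffineOpen_mem_and_subset (X := M.X) (x := M.centre v)
    (U := ⊤) trivial
  have hU' : genericPoint M.X ∈ U := centreChart_genericPoint_mem hxU
  have hx'V : M'.centre v ∈ φ.f ⁻¹ᵁ U := by
    show φ.f (M'.centre v) ∈ U
    rw [φ.map_centre]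
    exact hxU
  have hV : IsAffineOpen (φ.f ⁻¹ᵁ U) := hU.preimage φ.f
  have hV' : genericPoint M'.X ∈ φ.f ⁻¹ᵁ U := centreChart_genericPoint_mem hx'V
  -- the two charts
  obtain ⟨-, A, hAc, -, -, hAle, hAloc⟩ := hchart k K M v U hU hxU
  obtain ⟨-, A', hA'c, -, hA'fr, -, hA'loc⟩ := hchart k K M' v (φ.f ⁻¹ᵁ U) hV hx'V
  have hA := normalizationStage_toSubring_eq_secRange M hxU A hAc
  have hA' := normalizationStage_toSubring_eq_secRange M' hx'V A' hA'c
  haveI := hA'fr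
  -- `A' = nrm A`
  have key : A' = nrm A :=
    normalizationStage_chart_eq_nrm φ hU' hV' (IsIntegralHom.isIntegral_app φ.f U hU)
      (hnorm U hU ⟨⟨_, hxU⟩⟩) A A' hA hA'
  -- `C = locAt 𝒪_v A`, and normalisation commutes with localisation
  have hCA : C = locAt v.asValuationSubring A :=
    Subalgebra.toSubring_injective (hC.trans hAloc.symm)
  have hk : ∀ c : k, algebraMap k K c ∈ v.asValuationSubring := fun c => hAle (A.algebraMap_mem c)
  have e1 : locAt v.asValuationSubring (nrm C) = locAt v.asValuationSubring A' := by
    rw [hCA, stub_nrm_locAt k K v.asValuationSubring A hk hAle, key]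
  rw [e1]
  exact hA'loc

end Summit.ResolutionOfSingularities.ResolutionOfSingularities.Theorems.SyzygyFlattening

end
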